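import Literature.AlgebraicGeometry.HodgeTheory.HodgeFiltrationModels
import Literature.Geometry.Kaehler.SmoothHermitianBundleChernCharacter
import Summits.HodgeConjecture.HodgeConjecture.Theses.HolomorphicDefect

/-!
# Route HolomorphicDefect — the linear glue `GaugeToConiveau` (item stmt-HodgeConjecture-3030)

The support item `GaugeToConiveau := HodgeClassesFromApproxHYM → ApproxHYMConiveauOne →
HodgeClassesConiveauOne` of route `HolomorphicDefect` says that FLEXIBILITY (every rational
`(p,p)`-class, `p ≥ 1`, pulls back to a Hodge model `A` as a finite `ℚ`-combination
`A.pullback c = Σᵢ qᵢ • ch_p(Gᵢ)` of Chern characters of approximately Hermitian–Yang–Mills `C^∞`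
Hermitian bundles `Gᵢ` with Hodge Chern character) and RIGIDITY (for such a bundle `G`, every class
`c'` with `A.pullback c' = ch_p(G)` lies in `N¹H²ᵖ = supportedClasses X (2p) 1`) together give the
route's thesis `HodgeClassesConiveauOne`.  The content is linear algebra only: the pull-back
`A.pullback (2p) : H²ᵖ(X(ℂ); ℂ) → H²ᵖ(X^an; ℂ)` along the comparison homeomorphism is bijective
(`HodgeModel.pullback_surjective` / `pullback_injective`, functoriality of singular cohomology),
so each `ch_p(Gᵢ) = A.pullback cᵢ` with `cᵢ ∈ N¹` by rigidity, and `c = Σᵢ qᵢ cᵢ ∈ N¹`, a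
`ℂ`-subspace.

At the time of writing the two gauge cruxes `HodgeClassesFromApproxHYM` (stmt-HodgeConjecture-3029)
and `ApproxHYMConiveauOne` (stmt-HodgeConjecture-3028) are not yet rendered as declarations of the
route file (they were filed over then-missing notions `SmoothHermitianBundle`, `.chernCharacter`,
`.IsApproxHermitianYangMills`, all of which have since landed in `Literature/Geometry/Kaehler/`).
This file therefore proves the glue with the two cruxes INLINED VERBATIM (their ledger signatures)
as hypotheses `hF`, `hR`, concluding the route decl `HodgeClassesConiveauOne` itself; once the route
file renders the three items, `GaugeToConiveau` is this theorem after `unfold`.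

References: T. R. Ramadas, *Spin(7) instantons and the Hodge Conjecture for certain abelian
four-folds: a modest proposal*, arXiv:0809.3927 (the K-theoretic frame); A. Hatcher, *Algebraic
Topology* (2002), §3.1 (functoriality of singular cohomology).
-/

-- `Summit.HodgeConjecture.HodgeConjecture.Theorems` is the mandated namespace (single-problem summit:
-- Problem = Summit), which `linter.dupNamespace` flags on every declaration; the lakefile turns the
-- linter off for the Summits library (weak option), restated here so stand-alone elaboration is warning-free.
set_option linter.dupNamespace false

open scoped Manifold ContDiff

namespace Summit.HodgeConjecture.HodgeConjecture.Theorems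

open Literature.AlgebraicGeometry.Motives Literature.AlgebraicGeometry.HodgeTheory
  Literature.AlgebraicTopology.SingularHomology Literature.Geometry.Kaehler

/-- **Linear glue on a Hodge model.** If the pull-back `A.pullback k c ∈ Hᵏ(X^an; ℂ)` of a class
`c ∈ Hᵏ(X(ℂ); ℂ)` is a finite combination `Σ_{i ∈ s} aᵢ • γᵢ` of classes `γᵢ` each of which is the
pull-back of SOME class supported in codimension `≥ r`, then `c` itself is supported in codimension
`≥ r`: `A.pullback k` is injective (comparison homeomorphism) and `supportedClasses X k r` is a
`ℂ`-subspace. [folklore; Hatcher, Algebraic Topology §3.1 (functoriality)] -/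
theorem mem_supportedClasses_of_pullback_eq_sum {n : ℕ} {X : SchemeOver ℂ} (A : HodgeModel n X)
    {k r : ℕ} {ι : Type*} (s : Finset ι) (a : ι → ℂ)
    (γ : ι → singularCohomology ℂ ℂ A.carrier k)
    (hγ : ∀ i ∈ s, ∃ c' ∈ supportedClasses X k r, A.pullback k c' = γ i)
    {c : singularCohomology ℂ ℂ (ComplexPoints X) k}
    (hc : A.pullback k c = ∑ i ∈ s, a i • γ i) : c ∈ supportedClasses X k r := by
  choose! f hf using hγ
  have key : A.pullback k c = A.pullback k (∑ i ∈ s, a i • f i) := by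
    rw [hc, map_sum]
    exact Finset.sum_congr rfl fun i hi ↦ by rw [map_smul, (hf i hi).2]
  rw [A.pullback_injective k key]
  exact Submodule.sum_mem _ fun i hi ↦ Submodule.smul_mem _ _ (hf i hi).1

/-- **`GaugeToConiveau` (item stmt-HodgeConjecture-3030), with the two gauge cruxes inlined.**
FLEXIBILITY `hF` (= crux `HodgeClassesFromApproxHYM`, stmt-HodgeConjecture-3029, verbatim: every
rational `(p,p)`-class with `p ≥ 1` pulls back to a Hodge model as a finite `ℚ`-combination of
`p`-th Chern characters of approximately Hermitian–Yang–Mills `C^∞` Hermitian bundles with Hodge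
Chern character) and RIGIDITY `hR` (= crux `ApproxHYMConiveauOne`, stmt-HodgeConjecture-3028,
verbatim: a class pulling back to the `p`-th Chern character, `p ≥ 1`, of such a bundle lies in
`N¹H²ᵖ`) give the thesis `HodgeClassesConiveauOne` of route `HolomorphicDefect`: unfold
`IsOfHodgeType` to get a Hodge model `A` with `A.pullback c ∈ H^{p,p}`, expand by `hF`, pick
preimages `cᵢ` of the `ch_p(Gᵢ)` under the surjective `A.pullback` and put them in `N¹` by `hR`,
conclude by `mem_supportedClasses_of_pullback_eq_sum`. [folklore; Ramadas, arXiv:0809.3927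
(K-theoretic frame)] -/
theorem hodgeClassesConiveauOne_of_flexibility_of_rigidity
    (hF : ∀ ⦃n : ℕ⦄ ⦃X : Literature.AlgebraicGeometry.Motives.SchemeOver ℂ⦄,
      Literature.AlgebraicGeometry.Motives.IsSmoothProjective n X →
        ∀ (A : Literature.AlgebraicGeometry.HodgeTheory.HodgeModel n X) (p : ℕ)
          (c : Literature.AlgebraicTopology.SingularHomology.singularCohomology ℂ ℂ
            (Literature.AlgebraicGeometry.Motives.ComplexPoints X) (2 * p)),
          1 ≤ p → Literature.AlgebraicGeometry.HodgeTheory.IsRationalClass c →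
            A.pullback (2 * p) c ∈ A.hodgePQ (2 * p) p p →
              ∃ (ι : Type) (s : Finset ι) (q : ι → ℚ)
                (G : ι → Literature.Geometry.Kaehler.SmoothHermitianBundle A.model A.carrier)
                (g : ι → Bundle.ContMDiffRiemannianMetric 𝓘(ℝ, A.model) (⊤ : ℕ∞) A.model
                  (fun x : A.carrier ↦ TangentSpace 𝓘(ℝ, A.model) x)),
                (∀ i ∈ s, (G i).IsApproxHermitianYangMills (g i) ∧
                  ∀ k : ℕ, 1 ≤ k → (G i).chernCharacter A.deRham k ∈ A.hodgePQ (2 * k) k k) ∧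
                A.pullback (2 * p) c = ∑ i ∈ s, ((q i : ℚ) : ℂ) • (G i).chernCharacter A.deRham p)
    (hR : ∀ ⦃n : ℕ⦄ ⦃X : Literature.AlgebraicGeometry.Motives.SchemeOver ℂ⦄,
      Literature.AlgebraicGeometry.Motives.IsSmoothProjective n X →
        ∀ (A : Literature.AlgebraicGeometry.HodgeTheory.HodgeModel n X)
          (g : Bundle.ContMDiffRiemannianMetric 𝓘(ℝ, A.model) (⊤ : ℕ∞) A.model
            (fun x : A.carrier ↦ TangentSpace 𝓘(ℝ, A.model) x))
          (F : Literature.Geometry.Kaehler.SmoothHermitianBundle A.model A.carrier),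
          F.IsApproxHermitianYangMills g →
            (∀ k : ℕ, 1 ≤ k → F.chernCharacter A.deRham k ∈ A.hodgePQ (2 * k) k k) →
              ∀ (p : ℕ) (c : Literature.AlgebraicTopology.SingularHomology.singularCohomology ℂ ℂ
                (Literature.AlgebraicGeometry.Motives.ComplexPoints X) (2 * p)),
                1 ≤ p → A.pullback (2 * p) c = F.chernCharacter A.deRham p →
                  c ∈ Literature.AlgebraicGeometry.HodgeTheory.supportedClasses X (2 * p) 1) :
    Summit.HodgeConjecture.HodgeConjecture.Theses.HolomorphicDefect.HodgeClassesConiveauOne := by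
  unfold Summit.HodgeConjecture.HodgeConjecture.Theses.HolomorphicDefect.HodgeClassesConiveauOne
  intro n X hX p c hp hc hpp
  obtain ⟨A, hA⟩ := hpp
  obtain ⟨ι, s, q, G, g, hG, hsum⟩ := hF hX A p c hp hc hA
  refine mem_supportedClasses_of_pullback_eq_sum A s (fun i ↦ ((q i : ℚ) : ℂ))
    (fun i ↦ (G i).chernCharacter A.deRham p) (fun i hi ↦ ?_) hsum
  obtain ⟨c', hc'⟩ := A.pullback_surjective (2 * p) ((G i).chernCharacter A.deRham p)
  exact ⟨c', hR hX A (g i) (G i) (hG i hi).1 (hG i hi).2 p c' hp hc', hc'⟩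

end Summit.HodgeConjecture.HodgeConjecture.Theorems

namespace Summit.HodgeConjecture.HodgeConjecture.Theorems

open Literature.AlgebraicGeometry.Motives Literature.AlgebraicGeometry.HodgeTheory
  Literature.AlgebraicTopology.SingularHomology Literature.Geometry.Kaehler

/-! ### Variants robust to the normalisation of the de Rham comparison

A Hodge model `A` carries an arbitrary NATURAL complex de Rham comparison family `A.deRham`;
rescaling it in degree `2p` by any non-zero complex scalar `t` gives another Hodge model `A_t` with
the same `pullback` and the same pieces `hodgePQ`, but with `ch_p^{A_t}(G) = t • ch_p^{A}(G)` for
every bundle `G` (`SmoothHermitianBundle.chernCharacter` is linear in the comparison).  A flexibility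
statement with RATIONAL coefficients `q : ι → ℚ` quantified over all Hodge models is therefore not
the robust form (for `t` outside a countable set no non-zero rational class is a `ℚ`-combination of
the rescaled Chern characters, these being `t`-multiples of rational classes); the glue needs only
`ℂ`-linearity, `supportedClasses X (2p) 1` being a `ℂ`-subspace.  The two theorems below are the
glue for the `ℂ`-coefficient and the span forms of flexibility, with rigidity unchanged. -/

/-- **`GaugeToConiveau`, complex-coefficient form.** As
`hodgeClassesConiveauOne_of_flexibility_of_rigidity`, with flexibility `hF` asserting a finite
`ℂ`-combination `A.pullback c = Σ_{i ∈ s} aᵢ • ch_p(Gᵢ)` (`a : ι → ℂ`) of Chern characters of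
approximately Hermitian–Yang–Mills `C^∞` Hermitian bundles with Hodge Chern character, and rigidity
`hR` verbatim the crux `ApproxHYMConiveauOne` (stmt-HodgeConjecture-3028). [folklore] -/
theorem hodgeClassesConiveauOne_of_complexFlexibility_of_rigidity
    (hF : ∀ ⦃n : ℕ⦄ ⦃X : Literature.AlgebraicGeometry.Motives.SchemeOver ℂ⦄,
      Literature.AlgebraicGeometry.Motives.IsSmoothProjective n X →
        ∀ (A : Literature.AlgebraicGeometry.HodgeTheory.HodgeModel n X) (p : ℕ)
          (c : Literature.AlgebraicTopology.SingularHomology.singularCohomology ℂ ℂ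
            (Literature.AlgebraicGeometry.Motives.ComplexPoints X) (2 * p)),
          1 ≤ p → Literature.AlgebraicGeometry.HodgeTheory.IsRationalClass c →
            A.pullback (2 * p) c ∈ A.hodgePQ (2 * p) p p →
              ∃ (ι : Type) (s : Finset ι) (a : ι → ℂ)
                (G : ι → Literature.Geometry.Kaehler.SmoothHermitianBundle A.model A.carrier)
                (g : ι → Bundle.ContMDiffRiemannianMetric 𝓘(ℝ, A.model) (⊤ : ℕ∞) A.model
                  (fun x : A.carrier ↦ TangentSpace 𝓘(ℝ, A.model) x)),
                (∀ i ∈ s, (G i).IsApproxHermitianYangMills (g i) ∧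
                  ∀ k : ℕ, 1 ≤ k → (G i).chernCharacter A.deRham k ∈ A.hodgePQ (2 * k) k k) ∧
                A.pullback (2 * p) c = ∑ i ∈ s, a i • (G i).chernCharacter A.deRham p)
    (hR : ∀ ⦃n : ℕ⦄ ⦃X : Literature.AlgebraicGeometry.Motives.SchemeOver ℂ⦄,
      Literature.AlgebraicGeometry.Motives.IsSmoothProjective n X →
        ∀ (A : Literature.AlgebraicGeometry.HodgeTheory.HodgeModel n X)
          (g : Bundle.ContMDiffRiemannianMetric 𝓘(ℝ, A.model) (⊤ : ℕ∞) A.model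
            (fun x : A.carrier ↦ TangentSpace 𝓘(ℝ, A.model) x))
          (F : Literature.Geometry.Kaehler.SmoothHermitianBundle A.model A.carrier),
          F.IsApproxHermitianYangMills g →
            (∀ k : ℕ, 1 ≤ k → F.chernCharacter A.deRham k ∈ A.hodgePQ (2 * k) k k) →
              ∀ (p : ℕ) (c : Literature.AlgebraicTopology.SingularHomology.singularCohomology ℂ ℂ
                (Literature.AlgebraicGeometry.Motives.ComplexPoints X) (2 * p)),
                1 ≤ p → A.pullback (2 * p) c = F.chernCharacter A.deRham p →
                  c ∈ Literature.AlgebraicGeometry.HodgeTheory.supportedClasses X (2 * p) 1) :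
    Summit.HodgeConjecture.HodgeConjecture.Theses.HolomorphicDefect.HodgeClassesConiveauOne := by
  unfold Summit.HodgeConjecture.HodgeConjecture.Theses.HolomorphicDefect.HodgeClassesConiveauOne
  intro n X hX p c hp hc hpp
  obtain ⟨A, hA⟩ := hpp
  obtain ⟨ι, s, a, G, g, hG, hsum⟩ := hF hX A p c hp hc hA
  refine mem_supportedClasses_of_pullback_eq_sum A s a
    (fun i ↦ (G i).chernCharacter A.deRham p) (fun i hi ↦ ?_) hsum
  obtain ⟨c', hc'⟩ := A.pullback_surjective (2 * p) ((G i).chernCharacter A.deRham p)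
  exact ⟨c', hR hX A (g i) (G i) (hG i hi).1 (hG i hi).2 p c' hp hc', hc'⟩

/-- **Linear glue, span form.** If `A.pullback k c` lies in the `ℂ`-span of a set `S` of classes
on the Hodge model each of which is the pull-back of some class supported in codimension `≥ r`,
then `c` is supported in codimension `≥ r` (`span S ≤ (supportedClasses X k r).map (A.pullback k)`
and `A.pullback k` is injective). [folklore; Hatcher, Algebraic Topology §3.1] -/
theorem mem_supportedClasses_of_pullback_mem_span {n : ℕ} {X : SchemeOver ℂ} (A : HodgeModel n X)
    {k r : ℕ} (S : Set (singularCohomology ℂ ℂ A.carrier k))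
    (hS : ∀ γ ∈ S, ∃ c' ∈ supportedClasses X k r, A.pullback k c' = γ)
    {c : singularCohomology ℂ ℂ (ComplexPoints X) k}
    (hc : A.pullback k c ∈ Submodule.span ℂ S) : c ∈ supportedClasses X k r := by
  have hle : Submodule.span ℂ S ≤ (supportedClasses X k r).map (A.pullback k).hom := by
    refine Submodule.span_le.2 fun γ hγ ↦ ?_
    obtain ⟨c', hc', rfl⟩ := hS γ hγ
    exact Submodule.mem_map_of_mem hc'
  obtain ⟨c', hc', hcc'⟩ := hle hc
  obtain rfl : c' = c := A.pullback_injective k hcc'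
  exact hc'

/-- **`GaugeToConiveau`, span form.** Flexibility `hF` asserting that the pull-back of every
rational `(p,p)`-class, `p ≥ 1`, lies in the `ℂ`-span of the `p`-th Chern characters `ch_p(G)` of
the approximately Hermitian–Yang–Mills `C^∞` Hermitian bundles `G` (for some smooth Riemannian,
necessarily Kähler, metric `g`) with Hodge Chern character, together with rigidity `hR` (verbatim
the crux `ApproxHYMConiveauOne`, stmt-HodgeConjecture-3028), gives `HodgeClassesConiveauOne`.
[folklore; Ramadas, arXiv:0809.3927 (K-theoretic frame)] -/
theorem hodgeClassesConiveauOne_of_spanFlexibility_of_rigidity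
    (hF : ∀ ⦃n : ℕ⦄ ⦃X : Literature.AlgebraicGeometry.Motives.SchemeOver ℂ⦄,
      Literature.AlgebraicGeometry.Motives.IsSmoothProjective n X →
        ∀ (A : Literature.AlgebraicGeometry.HodgeTheory.HodgeModel n X) (p : ℕ)
          (c : Literature.AlgebraicTopology.SingularHomology.singularCohomology ℂ ℂ
            (Literature.AlgebraicGeometry.Motives.ComplexPoints X) (2 * p)),
          1 ≤ p → Literature.AlgebraicGeometry.HodgeTheory.IsRationalClass c →
            A.pullback (2 * p) c ∈ A.hodgePQ (2 * p) p p →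
              A.pullback (2 * p) c ∈ Submodule.span ℂ
                {γ | ∃ (G : Literature.Geometry.Kaehler.SmoothHermitianBundle A.model A.carrier)
                  (g : Bundle.ContMDiffRiemannianMetric 𝓘(ℝ, A.model) (⊤ : ℕ∞) A.model
                    (fun x : A.carrier ↦ TangentSpace 𝓘(ℝ, A.model) x)),
                  G.IsApproxHermitianYangMills g ∧
                    (∀ k : ℕ, 1 ≤ k → G.chernCharacter A.deRham k ∈ A.hodgePQ (2 * k) k k) ∧
                      γ = G.chernCharacter A.deRham p})
    (hR : ∀ ⦃n : ℕ⦄ ⦃X : Literature.AlgebraicGeometry.Motives.SchemeOver ℂ⦄,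
      Literature.AlgebraicGeometry.Motives.IsSmoothProjective n X →
        ∀ (A : Literature.AlgebraicGeometry.HodgeTheory.HodgeModel n X)
          (g : Bundle.ContMDiffRiemannianMetric 𝓘(ℝ, A.model) (⊤ : ℕ∞) A.model
            (fun x : A.carrier ↦ TangentSpace 𝓘(ℝ, A.model) x))
          (F : Literature.Geometry.Kaehler.SmoothHermitianBundle A.model A.carrier),
          F.IsApproxHermitianYangMills g →
            (∀ k : ℕ, 1 ≤ k → F.chernCharacter A.deRham k ∈ A.hodgePQ (2 * k) k k) →
              ∀ (p : ℕ) (c : Literature.AlgebraicTopology.SingularHomology.singularCohomology ℂ ℂ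
                (Literature.AlgebraicGeometry.Motives.ComplexPoints X) (2 * p)),
                1 ≤ p → A.pullback (2 * p) c = F.chernCharacter A.deRham p →
                  c ∈ Literature.AlgebraicGeometry.HodgeTheory.supportedClasses X (2 * p) 1) :
    Summit.HodgeConjecture.HodgeConjecture.Theses.HolomorphicDefect.HodgeClassesConiveauOne := by
  unfold Summit.HodgeConjecture.HodgeConjecture.Theses.HolomorphicDefect.HodgeClassesConiveauOne
  intro n X hX p c hp hc hpp
  obtain ⟨A, hA⟩ := hpp
  refine mem_supportedClasses_of_pullback_mem_span A _ (fun γ hγ ↦ ?_) (hF hX A p c hp hc hA)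
  obtain ⟨G, g, hG, hGH, rfl⟩ := hγ
  obtain ⟨c', hc'⟩ := A.pullback_surjective (2 * p) (G.chernCharacter A.deRham p)
  exact ⟨c', hR hX A g G hG hGH p c' hp hc', hc'⟩

/-- **Item stmt-HodgeConjecture-17635 (`GaugeToConiveau`), route `HolomorphicDefect`** — the route
decl itself: `HodgeClassesFromApproxHYM → ApproxHYMConiveauOne → HodgeClassesConiveauOne`, whose two
hypotheses are verbatim the `hF` / `hR` of `hodgeClassesConiveauOne_of_spanFlexibility_of_rigidity`
above (span of the approximately-HYM Chern characters ≤ pull-back of `N¹` by surjectivity of the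
pull-back and the rigidity crux; conclude by injectivity of the pull-back).
[folklore; Hatcher, Algebraic Topology §3.1] -/
theorem holomorphicDefect_gaugeToConiveau_proof :
    Summit.HodgeConjecture.HodgeConjecture.Theses.HolomorphicDefect.GaugeToConiveau :=
  fun hF hR ↦ hodgeClassesConiveauOne_of_spanFlexibility_of_rigidity hF hR

end Summit.HodgeConjecture.HodgeConjecture.Theorems
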